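import Literature.Geometry.Kaehler.HypersurfaceExtensionChart
import Literature.Analysis.Complex.TransversalHypersurfaces
import HarnessLib

/-!
# A transversal pair of hypersurface equations is a regular pair on a chart set of a complex manifold

Transport of E. M. Chirka's regular-pair statement `Literature.Analysis.Complex.SCV.exists_eq_smul_of_mul_eq_mul`
(*Complex Analytic Sets* (1989), §2.8: `t₂ f = t₁ g ⟹ t₁ ∣ f` for holomorphic `t₁, t₂` with
`dt₁ ≠ 0` on `{t₁ = 0}` and `dt₁, dt₂` independent on `{t₁ = t₂ = 0}`) to the chart sets
`chartSet 𝓘(ℝ, E) x₀ C` of a complex manifold, with the differential conditions in the manifold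
form `mfderiv` delivered by the algebraic transversality theorems of
`Literature.AlgebraicGeometry.HodgeTheory.BertiniPencilAnalytic` (`exists_transverse_flag`):

* `not_surjective_pi_of_eq_smul` — if `L₂ = c • L₁` then `v ↦ (L₁ v, L₂ v)` is not onto `ℂ²`
  (so "jointly surjective differentials" implies Chirka's non-proportionality);
* `exists_mdifferentiableOn_eq_mul_of_mul_eq_mul_chartSet` — on `W = chartSet 𝓘(ℝ, E) x₀ C`
  (`C` open in the chart target), for `t₁, t₂, f` holomorphic on `W` with `dt₁ ≠ 0` on
  `W ∩ {t₁ = 0}` and `dt₂ ∉ ℂ dt₁` on `W ∩ {t₁ = t₂ = 0}`, `t₂ f = t₁ g` on `W` forces `f = t₁ h`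
  with `h` holomorphic on `W` — the injectivity of "multiplication by `t₂`" on `𝒪/t₁𝒪` over the
  members of the nested Leray covers, i.e. the injectivity of the maps `𝓠_m → 𝓠_{m+1}` of the
  hyperplane-section tower (Serre, GAGA n° 16 Lemme 8).

Everything is proved; theorems only.

## References

* E. M. Chirka, *Complex Analytic Sets* (1989), §2.8. [Chirka1989]
* J.-P. Serre, *Géométrie algébrique et géométrie analytique* (1956), n° 16 Lemme 8. [SerreGAGA1956]
-/

noncomputable section

open scoped Manifold ContDiff Topology
open Set Filter Literature.Analysis.Complex

namespace Literature.Geometry.Kaehler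

/-- If `L₂ = c • L₁` then `v ↦ (L₁ v, L₂ v)ᵢ` is not surjective onto `Fin 2 → ℂ` (the value
`(1, c + 1)` is missed). [folklore] -/
theorem not_surjective_pi_of_eq_smul {V : Type*} [AddCommGroup V] [Module ℂ V] [TopologicalSpace V]
    {L₁ L₂ : V →L[ℂ] ℂ} {c : ℂ} (h : L₂ = c • L₁) :
    ¬ Function.Surjective (ContinuousLinearMap.pi fun i : Fin 2 ↦ (![L₁, L₂] i)) := by
  intro hs
  obtain ⟨v, hv⟩ := hs ![1, c + 1]
  have h1 : L₁ v = 1 := by simpa using congr_fun hv 0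
  have h2 : L₂ v = c + 1 := by simpa using congr_fun hv 1
  rw [h, FunLike.coe_smul, Pi.smul_apply, h1, smul_eq_mul, mul_one] at h2
  exact absurd h2 (by simp)

variable {E : Type*} [NormedAddCommGroup E] [NormedSpace ℂ E]
  {M : Type*} [TopologicalSpace M] [ChartedSpace E M] [IsManifold 𝓘(ℂ, E) ω M]

/-- **A transversal pair is a regular pair on a chart set**: on `W = chartSet 𝓘(ℝ, E) x₀ C`, if
`t₁, t₂, f` are holomorphic on `W`, `dt₁ ≠ 0` on `W ∩ {t₁ = 0}`, `dt₂ ∉ ℂ · dt₁` on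
`W ∩ {t₁ = t₂ = 0}` and `t₂ f = t₁ g` on `W`, then `f = t₁ h` on `W` with `h` holomorphic on `W`
(Chirka §2.8 read in the holomorphic chart at `x₀`). [cite: Chirka1989, §2.8] -/
theorem exists_mdifferentiableOn_eq_mul_of_mul_eq_mul_chartSet (x₀ : M) {C : Set E} (hCo : IsOpen C)
    (hCT : C ⊆ (extChartAt 𝓘(ℝ, E) x₀).target) {t₁ t₂ f g : M → ℂ}
    (ht₁ : MDifferentiableOn 𝓘(ℂ, E) 𝓘(ℂ, ℂ) t₁ (chartSet 𝓘(ℝ, E) x₀ C))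
    (ht₂ : MDifferentiableOn 𝓘(ℂ, E) 𝓘(ℂ, ℂ) t₂ (chartSet 𝓘(ℝ, E) x₀ C))
    (hf : MDifferentiableOn 𝓘(ℂ, E) 𝓘(ℂ, ℂ) f (chartSet 𝓘(ℝ, E) x₀ C))
    (hd₁ : ∀ x ∈ chartSet 𝓘(ℝ, E) x₀ C, t₁ x = 0 → mfderiv 𝓘(ℂ, E) 𝓘(ℂ, ℂ) t₁ x ≠ 0)
    (hind : ∀ x ∈ chartSet 𝓘(ℝ, E) x₀ C, t₁ x = 0 → t₂ x = 0 → ∀ c : ℂ,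
      mfderiv 𝓘(ℂ, E) 𝓘(ℂ, ℂ) t₂ x ≠ c • mfderiv 𝓘(ℂ, E) 𝓘(ℂ, ℂ) t₁ x)
    (h : ∀ x ∈ chartSet 𝓘(ℝ, E) x₀ C, t₂ x * f x = t₁ x * g x) :
    ∃ h : M → ℂ, MDifferentiableOn 𝓘(ℂ, E) 𝓘(ℂ, ℂ) h (chartSet 𝓘(ℝ, E) x₀ C) ∧
      ∀ x ∈ chartSet 𝓘(ℝ, E) x₀ C, f x = t₁ x * h x := by
  set φ := extChartAt 𝓘(ℂ, E) x₀ with hφ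
  set W := chartSet 𝓘(ℝ, E) x₀ C with hW
  have hWo : IsOpen W := isOpen_chartSet 𝓘(ℝ, E) x₀ hCo
  have hWs : W ⊆ φ.source := chartSet_subset_source 𝓘(ℝ, E) x₀ C
  have hφW : ∀ x ∈ W, φ x ∈ C := fun x hx ↦ (mem_chartSet_iff.1 hx).2
  have hsymm : ∀ y ∈ C, φ.symm y ∈ W := fun y hy ↦ symm_mem_chartSet hCT hy
  -- the data read in the chart
  have hrd : ∀ {u : M → ℂ}, MDifferentiableOn 𝓘(ℂ, E) 𝓘(ℂ, ℂ) u W → DifferentiableOn ℂ (u ∘ φ.symm) C :=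
    fun hu ↦ (differentiableOn_comp_extChartAt_symm_of_mdifferentiableOn hu hWo x₀).mono
      fun y hy ↦ ⟨hCT hy, hsymm y hy⟩
  have hts : ∀ {u : M → ℂ}, MDifferentiableOn 𝓘(ℂ, E) 𝓘(ℂ, ℂ) u W → ∀ y ∈ C,
      DifferentiableAt ℂ (u ∘ φ.symm) (φ (φ.symm y)) := fun hu y hy ↦ by
    rw [φ.right_inv (hCT hy)]
    exact (hrd hu).differentiableAt (hCo.mem_nhds hy)
  have hd₁' : ∀ y ∈ C, (t₁ ∘ φ.symm) y = 0 → fderiv ℂ (t₁ ∘ φ.symm) y ≠ 0 := fun y hy hty h0 ↦ by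
    have hx : φ.symm y ∈ W := hsymm y hy
    refine hd₁ _ hx hty ((mfderiv_eq_zero_iff_fderiv_comp_symm_eq_zero x₀ (hWs hx) (hts ht₁ y hy)).2 ?_)
    rw [φ.right_inv (hCT hy)]
    exact h0
  have hind' : ∀ y ∈ C, (t₁ ∘ φ.symm) y = 0 → (t₂ ∘ φ.symm) y = 0 → ∀ c : ℂ,
      fderiv ℂ (t₂ ∘ φ.symm) y ≠ c • fderiv ℂ (t₁ ∘ φ.symm) y := fun y hy h1y h2y c hc ↦ by
    have hx : φ.symm y ∈ W := hsymm y hy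
    have hxs : φ.symm y ∈ φ.source := hWs hx
    have hy' : φ (φ.symm y) = y := φ.right_inv (hCT hy)
    refine hind _ hx h1y h2y c ?_
    rw [mfderiv_eq_fderiv_comp_symm_comp x₀ hxs (hts ht₂ y hy),
      mfderiv_eq_fderiv_comp_symm_comp x₀ hxs (hts ht₁ y hy), hy', hc, ContinuousLinearMap.smul_comp]
    rfl
  have h' : ∀ y ∈ C, (t₂ ∘ φ.symm) y • (f ∘ φ.symm) y = (t₁ ∘ φ.symm) y • (g ∘ φ.symm) y :=
    fun y hy ↦ by simpa only [Function.comp_apply, smul_eq_mul] using h _ (hsymm y hy)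
  obtain ⟨h₀, hh₀, hfh⟩ := SCV.exists_eq_smul_of_mul_eq_mul hCo (hrd ht₁) (hrd ht₂) (hrd hf) hd₁' hind' h'
  refine ⟨fun x ↦ h₀ (φ x), fun x hx ↦ ?_, fun x hx ↦ ?_⟩
  · have hxs : x ∈ (chartAt E x₀).source := by
      rw [← extChartAt_source 𝓘(ℂ, E)]; exact hWs hx
    have h1 : MDifferentiableAt 𝓘(ℂ, E) 𝓘(ℂ, ℂ) h₀ (φ x) :=
      mdifferentiableAt_iff_differentiableAt.2 (hh₀.differentiableAt (hCo.mem_nhds (hφW x hx)))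
    exact (h1.comp x (mdifferentiableAt_extChartAt hxs)).mdifferentiableWithinAt
  · have h1 := hfh (φ x) (hφW x hx)
    simp only [Function.comp_apply, φ.left_inv (hWs hx), smul_eq_mul] at h1
    exact h1

end Literature.Geometry.Kaehler

end
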